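import Literature.Geometry.Kaehler.DolbeaultSymbolWedge
import Literature.Geometry.Kaehler.DolbeaultSymbolScalar
import Literature.NumberTheory.Transcendental.KaehlerLefschetzOperatorProofs
import HarnessLib

/-!
# The symbol of `Δ_∂̄` read in a chart, at the chart centre (Warner 6.35 for `Δ_∂̄`)

At the centre `y₀ = e(p)` of the chart at `p` the operators of `ChartDolbeaultOps` are the pointwise
linear algebra of the tangent space `T_p M = E` with its metric `g_p`, orientation `o p` and
complex structure `J = tangentJ` (`hodgeStarChartOp_centre`, `cStarOp_centre`), so the symbol of
`Δ_∂̄ = ∂̄∂̄* + ∂̄*∂̄` read in the chart, frozen at `y₀` and applied to `ξ ⊗ a`, is the scalar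
`-½ ‖ξ♯‖²_{g_p}` (`symbol_dolbeaultLaplacian_centre`, from `wedge_star_wedge_star_add` of
`DolbeaultSymbolScalar`, with the degree-`0` and top-degree companions). In particular it is
injective for `ξ ≠ 0`: the chart operator is elliptic at `p` (Warner 6.35).

## References

* F. W. Warner, GTM 94 (1983), 6.35. [WarnerGTM94]
-/

noncomputable section

open scoped Manifold ContDiff Topology RealInnerProductSpace
open Bundle Set Function Module Complex
open Literature.NumberTheory.Transcendental Literature.LinearAlgebra.Alternating

set_option maxSynthPendingDepth 2

namespace Literature.Geometry.Kaehler

/-- The complexified Hodge star at a point (pointwise value of `MForm.cHodgeStar`; notation of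
`KaehlerSymbolIdentityProofs`). -/
local notation "⋆ℂ[" o ", " h "]" η:max =>
  ContinuousLinearMap.compContinuousAlternatingMap Complex.ofRealCLM
      (hodgeStar o h (ContinuousLinearMap.compContinuousAlternatingMap Complex.reCLM η)) +
    Complex.I • ContinuousLinearMap.compContinuousAlternatingMap Complex.ofRealCLM
      (hodgeStar o h (ContinuousLinearMap.compContinuousAlternatingMap Complex.imCLM η))

section Model

variable {E : Type*} [NormedAddCommGroup E] [NormedSpace ℂ E] {k : ℕ}

/-- `covector01 = zeta01 (i·)` (the two spellings of `ξ^{0,1}` agree). [folklore] -/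
theorem covector01_eq_zeta01 (ξ : E →L[ℝ] ℝ) : covector01 ξ = zeta01 (mulI E) ξ := by
  ext v
  rw [covector01_apply, zeta01_apply, mulI_apply]; push_cast; ring_nf

/-- `covector10 = zeta10 (i·)`. [folklore] -/
theorem covector10_eq_zeta10 (ξ : E →L[ℝ] ℝ) : covector10 ξ = zeta10 (mulI E) ξ := by
  ext v
  rw [covector10_apply, zeta10_apply, mulI_apply]; push_cast; ring_nf

/-- A wedge with a complex covector of a negated form. [folklore] -/
theorem wedgeOne_neg_right (θ : E →L[ℝ] ℂ) (η : E [⋀^Fin k]→L[ℝ] ℂ) : wedgeOne θ (-η) = -wedgeOne θ η := by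
  rw [← neg_one_smul ℂ η, wedgeOne_smul, neg_one_smul]

end Model

section Centre

variable {E : Type*} [NormedAddCommGroup E] [NormedSpace ℂ E] [FiniteDimensional ℂ E]
  {n : ℕ} [Fact (finrank ℝ E = n)]
  {M : Type*} [TopologicalSpace M] [ChartedSpace E M] [IsManifold 𝓘(ℝ, E) ∞ M]
  [RiemannianBundle (fun x : M ↦ TangentSpace 𝓘(ℝ, E) x)]
  (o : (x : M) → Orientation ℝ (TangentSpace 𝓘(ℝ, E) x) (Fin n)) {k m : ℕ}

/-- **At the chart centre the chart Hodge star is the Hodge star of `T_p M`.** [folklore] -/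
theorem hodgeStarChartOp_centre (h : k + m = n) (p : M) (c : E [⋀^Fin k]→L[ℝ] ℝ) :
    hodgeStarChartOp (I := 𝓘(ℝ, E)) o h p (extChartAt 𝓘(ℝ, E) p p) c = hodgeStar (o p) h c := by
  set β : MForm 𝓘(ℝ, E) M ℝ k := fun _ ↦ c with hβ
  have h1 := MForm.inChart_hodgeStar_eq_op o h β (mem_extChartAt_target (I := 𝓘(ℝ, E)) p)
  rw [MForm.inChart_apply_self, MForm.inChart_apply_self, MForm.hodgeStar_apply] at h1
  exact h1.symm

/-- **At the chart centre the complex chart Hodge star is `⋆_ℂ` of `T_p M`.** [folklore] -/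
theorem cStarOp_centre (h : k + m = n) (p : M) (b : E [⋀^Fin k]→L[ℝ] ℂ) :
    cStarOp o h p (extChartAt 𝓘(ℝ, E) p p) b = ⋆ℂ[o p, h] b := by
  rw [cStarOp_apply, hodgeStarChartOp_centre, hodgeStarChartOp_centre]
  rfl

/-- The derivative coefficient of `∂̄*` read in a chart on `ξ ⊗ b`:
`-⋆'(ξ^{1,0} ∧ ⋆ b)` with the chart Hodge stars. [folklore] -/
theorem dolbeaultBarAdjointOp_B_smulRight (h : (k + 1) + m = n) (p : M) (y : E) (ξ : E →L[ℝ] ℝ)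
    (b : E [⋀^Fin (k + 1)]→L[ℝ] ℂ) :
    (dolbeaultBarAdjointOp o h p).B y (ξ.smulRight b) =
      -cStarOp o (show (m + 1) + k = n by omega) p y (wedgeOne (covector10 ξ) (cStarOp o h p y b)) := by
  have hc : (cStarOp o h p y).comp (ξ.smulRight b) = ξ.smulRight (cStarOp o h p y b) := by
    ext v; simp
  simp only [dolbeaultBarAdjointOp, ChartOp1.neg_B, ChartOp1.comp₀₁_B, ChartOp1.comp₁₀_B,
    _root_.neg_apply, ContinuousLinearMap.comp_apply, ContinuousLinearMap.compL_apply, hc,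
    dolbeaultOp_B_smulRight]

/-- **The symbol of `Δ_∂̄` at the chart centre is the scalar `-½ ‖ξ♯‖²`** (generic degree:
`(k+1)`-forms with `k + 1 < n`): for a Hermitian metric (`J` isometric) on an even-dimensional
model, `σ_∂̄ σ_∂̄* + σ_∂̄* σ_∂̄`, computed with the chart operators frozen at `y₀ = e(p)` and
applied to `ξ ⊗ a`, is `-½ ‖ξ♯‖²_{g_p} a` (Warner 6.35 made explicit; `wedge_star_wedge_star_add`).
[cite: WarnerGTM94, 6.35] -/
theorem symbol_dolbeaultLaplacian_centre (p : M) (hn : Even n)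
    (hH : ∀ v w : TangentSpace 𝓘(ℝ, E) p, ⟪tangentJ E p v, tangentJ E p w⟫ = ⟪v, w⟫)
    (ξ : E →L[ℝ] ℝ) {m' : ℕ} (h₁ : (k + 1) + m = n) (h₃ : (k + 1 + 1) + m' = n)
    (a : E [⋀^Fin (k + 1)]→L[ℝ] ℂ) :
    (dolbeaultBarOp E k).B (extChartAt 𝓘(ℝ, E) p p)
        (ξ.smulRight ((dolbeaultBarAdjointOp o h₁ p).B (extChartAt 𝓘(ℝ, E) p p) (ξ.smulRight a))) +
      (dolbeaultBarAdjointOp o h₃ p).B (extChartAt 𝓘(ℝ, E) p p)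
        (ξ.smulRight ((dolbeaultBarOp E (k + 1)).B (extChartAt 𝓘(ℝ, E) p p) (ξ.smulRight a))) =
      -(((2⁻¹ * ‖(InnerProductSpace.toDual ℝ (TangentSpace 𝓘(ℝ, E) p)).symm ξ‖ ^ 2 : ℝ) : ℂ) • a) := by
  have hJ : ∀ u v : TangentSpace 𝓘(ℝ, E) p, ⟪tangentJ E p u, v⟫ = -⟪u, tangentJ E p v⟫ := by
    intro u v
    have := hH u (tangentJ E p v)
    rw [tangentJ_tangentJ, inner_neg_right] at this
    linarith
  have key := wedge_star_wedge_star_add (V := TangentSpace 𝓘(ℝ, E) p) (o p) hn (tangentJ E p)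
    (tangentJ_tangentJ p) hJ ξ h₁ (show (m + 1) + k = n by omega) h₃ (show (m' + 1) + (k + 1) = n by omega) a
  rw [dolbeaultBarAdjointOp_B_smulRight, dolbeaultBarOp_B_smulRight, dolbeaultBarOp_B_smulRight,
    dolbeaultBarAdjointOp_B_smulRight, wedgeOne_neg_right, ← neg_add, cStarOp_centre, cStarOp_centre,
    cStarOp_centre, cStarOp_centre, covector01_eq_zeta01, covector10_eq_zeta10,
    ← wedgeOne_tangentSpace p, ← wedgeOne_tangentSpace p, ← wedgeOne_tangentSpace p, ← wedgeOne_tangentSpace p]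
  exact congrArg Neg.neg key

/-- **Degree `0`** (`Δ_∂̄ = ∂̄*∂̄` on functions): the frozen symbol on `ξ ⊗ η` is `-½ ‖ξ♯‖² η`.
[cite: WarnerGTM94, 6.35] -/
theorem symbol_dolbeaultLaplacian_centre_zero (p : M) (hn : Even n)
    (hH : ∀ v w : TangentSpace 𝓘(ℝ, E) p, ⟪tangentJ E p v, tangentJ E p w⟫ = ⟪v, w⟫)
    (ξ : E →L[ℝ] ℝ) {m' : ℕ} (h₃ : (0 + 1) + m' = n) (η : E [⋀^Fin 0]→L[ℝ] ℂ) :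
    (dolbeaultBarAdjointOp o h₃ p).B (extChartAt 𝓘(ℝ, E) p p)
        (ξ.smulRight ((dolbeaultBarOp E 0).B (extChartAt 𝓘(ℝ, E) p p) (ξ.smulRight η))) =
      -(((2⁻¹ * ‖(InnerProductSpace.toDual ℝ (TangentSpace 𝓘(ℝ, E) p)).symm ξ‖ ^ 2 : ℝ) : ℂ) • η) := by
  have hJ : ∀ u v : TangentSpace 𝓘(ℝ, E) p, ⟪tangentJ E p u, v⟫ = -⟪u, tangentJ E p v⟫ := by
    intro u v
    have := hH u (tangentJ E p v)
    rw [tangentJ_tangentJ, inner_neg_right] at this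
    linarith
  have key := star_wedge_star_wedge_zero (V := TangentSpace 𝓘(ℝ, E) p) (o p) hn (tangentJ E p)
    (tangentJ_tangentJ p) hJ ξ h₃ (show (m' + 1) + 0 = n by omega) η
  rw [dolbeaultBarAdjointOp_B_smulRight, dolbeaultBarOp_B_smulRight, cStarOp_centre, cStarOp_centre,
    covector01_eq_zeta01, covector10_eq_zeta10, ← wedgeOne_tangentSpace p, ← wedgeOne_tangentSpace p]
  exact congrArg Neg.neg key

/-- **Top degree** (`Δ_∂̄ = ∂̄∂̄*` on `n`-forms, `k + 1 = n`): the frozen symbol on `ξ ⊗ a` is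
`-½ ‖ξ♯‖² a`. [cite: WarnerGTM94, 6.35] -/
theorem symbol_dolbeaultLaplacian_centre_top (p : M) (hn : Even n)
    (hH : ∀ v w : TangentSpace 𝓘(ℝ, E) p, ⟪tangentJ E p v, tangentJ E p w⟫ = ⟪v, w⟫)
    (ξ : E →L[ℝ] ℝ) (h₁ : (k + 1) + 0 = n) (a : E [⋀^Fin (k + 1)]→L[ℝ] ℂ) :
    (dolbeaultBarOp E k).B (extChartAt 𝓘(ℝ, E) p p)
        (ξ.smulRight ((dolbeaultBarAdjointOp o h₁ p).B (extChartAt 𝓘(ℝ, E) p p) (ξ.smulRight a))) =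
      -(((2⁻¹ * ‖(InnerProductSpace.toDual ℝ (TangentSpace 𝓘(ℝ, E) p)).symm ξ‖ ^ 2 : ℝ) : ℂ) • a) := by
  have hJ : ∀ u v : TangentSpace 𝓘(ℝ, E) p, ⟪tangentJ E p u, v⟫ = -⟪u, tangentJ E p v⟫ := by
    intro u v
    have := hH u (tangentJ E p v)
    rw [tangentJ_tangentJ, inner_neg_right] at this
    linarith
  have key := wedge_star_wedge_star_top (V := TangentSpace 𝓘(ℝ, E) p) (o p) hn (tangentJ E p)
    (tangentJ_tangentJ p) hJ ξ h₁ (show (0 + 1) + k = n by omega) a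
  rw [dolbeaultBarAdjointOp_B_smulRight, dolbeaultBarOp_B_smulRight, wedgeOne_neg_right, cStarOp_centre,
    cStarOp_centre, covector01_eq_zeta01, covector10_eq_zeta10, ← wedgeOne_tangentSpace p,
    ← wedgeOne_tangentSpace p]
  exact congrArg Neg.neg key

end Centre

end Literature.Geometry.Kaehler
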